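import Summits.MatrixMultiplication.MatrixMultiplication.Theorems.ObstructionDescentUniversalOccurrenceTwoRectangleStorey
import Summits.MatrixMultiplication.MatrixMultiplication.Theorems.ObstructionDescentUniversalOccurrenceTwoRectangleCrossLiftArith

set_option linter.dupNamespace false
set_option autoImplicit false

/-!
# Universal occurrence — two rectangles: block-sign lemmas for TWO-SLOT TWISTS (decomp-mm · lens 3 · gen 46, K36-A)

Route `route-MatrixMultiplication-ObstructionDescent` (sub-problem `MatrixMultiplication`, `ω(ℂ) = 2`); SUPPORT for the crux
`NoOccurrenceObstruction` (`P_O`, item `stmt-MatrixMultiplication-29040`), universal-occurrence programme.  No `def`, no `sorry`.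

Elementary calculus of the block sign `ζ_e` (`wordBlockSign`, two blocks of `N` slots) under the DOUBLE CROSS
`κ = (A B)(C D)` exchanging the two blocks at two slots `s ≠ s'` (`A = (b,s)`, `B = (b',s)`, `C = (b,s')`, `D = (b',s')`),
the device behind the storey design `D″(N)` for the types `((2^N),(2^N),(2N-7,3,3,1))` (`…TwoRectangleTwistSign`,
`…TwoRectangleThreeThreeOne`):
* `bijective_agree_off_one`, `word_eq_of_agree_off_cross`: two block-bijective words that agree off ONE CROSS PAIR (one
  position in each block) are equal — the workhorse that turns a handful of value relations into an identity of words;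
* `wordBlockSign_comp_blockRelabel`: relabelling the blocks (`u ↦ u ∘ β`, `β` a lift of a permutation of the block index)
  does not change `ζ_e`;
* `wordBlockSign_comp_doubleCross`: if `u` and `u ∘ κ` are both block-bijective then `ζ_e(u ∘ κ) = ζ_e(u)` (the two blocks
  either agree or cross at the two slots, `bijective_agree_off_two`);
* the three VALUE PATTERNS of the separated configurations of `D″(N)` (`twist_diag_eq`, `twist_vertPair_eq`,
  `twist_diagPair_eq`): in each, the twisted second leg `χ` agrees with an explicit even rearrangement of the first leg `x`
  inside the blocks off one cross pair, hence `ζ_e(χ) = ζ_e(x)`.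

[cite: BurgisserIkenmeyer2011, Thm. 4.4, Lemma 6.1] [cite: BurgisserIkenmeyer2017, §5, Thm. 5.9 (proof of (2)), Thm. 5.13 (proof)]
-/

noncomputable section

open scoped BigOperators

namespace Summit.MatrixMultiplication.MatrixMultiplication.Theorems.ObstructionCalculus

open Literature.Computability.AlgebraicComplexity
open Literature.NumberTheory.DiophantineGeometry (Word)

/-! ### §1 Agreement off one slot / off one cross pair -/

/-- Two bijections of `Fin N` that agree off one slot are equal. [folklore] -/
theorem bijective_agree_off_one {N : ℕ} {f g : Fin N → Fin N} (hf : Function.Bijective f) (hg : Function.Bijective g)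
    {s₀ : Fin N} (h : ∀ s, s ≠ s₀ → f s = g s) : f = g := by
  funext s
  by_cases hs : s = s₀
  · subst hs
    obtain ⟨t, ht⟩ := hg.2 (f s)
    by_cases hts : t = s
    · subst hts; exact ht.symm
    · exact absurd (hf.1 ((h t hts).trans ht)) hts
  · exact h s hs

/-- Reading a position back from its block coordinates. [folklore] -/
theorem blockEquiv_symm_apply_eq {D δ N : ℕ} (e : Fin D ≃ Fin δ × Fin N) {a : Fin δ} {j : Fin N} {p : Fin D}
    (hq : e.symm (a, j) = p) : a = (e p).1 ∧ j = (e p).2 := by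
  have h := congrArg e hq
  rw [Equiv.apply_symm_apply] at h
  exact ⟨(congrArg Prod.fst h : _), (congrArg Prod.snd h : _)⟩

/-- **Two block-bijective words that agree off one cross pair are equal** (`p`, `p'` in different blocks). [this node] -/
theorem word_eq_of_agree_off_cross {D δ N : ℕ} (e : Fin D ≃ Fin δ × Fin N) {u u' : Word N D}
    (hu : wordBlockSign ℂ e u ≠ 0) (hu' : wordBlockSign ℂ e u' ≠ 0) {p p' : Fin D} (hpp' : (e p).1 ≠ (e p').1)
    (h : ∀ q, q ≠ p → q ≠ p' → u q = u' q) : u = u' := by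
  have key : ∀ a : Fin δ, (fun j => u (e.symm (a, j))) = (fun j => u' (e.symm (a, j))) := by
    intro a
    by_cases ha : a = (e p').1
    · refine bijective_agree_off_one (bijective_of_wordBlockSign_ne_zero e hu a)
        (bijective_of_wordBlockSign_ne_zero e hu' a) (s₀ := (e p').2) fun j hj => h _ ?_ ?_
      · intro hq
        exact hpp' (((blockEquiv_symm_apply_eq e hq).1.symm.trans ha).symm).symm
      · intro hq
        exact hj (blockEquiv_symm_apply_eq e hq).2
    · refine bijective_agree_off_one (bijective_of_wordBlockSign_ne_zero e hu a)
        (bijective_of_wordBlockSign_ne_zero e hu' a) (s₀ := (e p).2) fun j hj => h _ ?_ ?_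
      · intro hq
        exact hj (blockEquiv_symm_apply_eq e hq).2
      · intro hq
        exact ha (blockEquiv_symm_apply_eq e hq).1
  funext q
  have h1 := congrFun (key (e q).1) (e q).2
  simpa only [Prod.mk.eta, Equiv.symm_apply_apply] using h1

/-- Two functions on `Fin D` that agree at four named positions and off them are equal (bookkeeping). [folklore] -/
theorem funext_off_four {D : ℕ} {α : Type*} {f g : Fin D → α} (A B C D' : Fin D) (hA : f A = g A) (hB : f B = g B)
    (hC : f C = g C) (hD : f D' = g D') (h : ∀ q, q ≠ A → q ≠ B → q ≠ C → q ≠ D' → f q = g q) : f = g := by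
  funext q
  by_cases hqA : q = A
  · rw [hqA, hA]
  by_cases hqB : q = B
  · rw [hqB, hB]
  by_cases hqC : q = C
  · rw [hqC, hC]
  by_cases hqD : q = D'
  · rw [hqD, hD]
  exact h q hqA hqB hqC hqD

/-! ### §2 Relabelling the blocks -/

/-- **Relabelling the blocks does not change the block sign**: if `β` permutes the positions by a permutation `σ` of the
block index (same slot), then `ζ_e(u ∘ β) = ζ_e(u)` (the product over the blocks is merely re-indexed). [folklore] -/
theorem wordBlockSign_comp_blockRelabel {D δ N : ℕ} (e : Fin D ≃ Fin δ × Fin N) (σ : Equiv.Perm (Fin δ))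
    (β : Equiv.Perm (Fin D)) (hβ : ∀ q, e (β q) = (σ (e q).1, (e q).2)) (u : Word N D) :
    wordBlockSign ℂ e (u ∘ ⇑β) = wordBlockSign ℂ e u := by
  have hblk : ∀ a j, β (e.symm (a, j)) = e.symm (σ a, j) := by
    intro a j
    apply e.injective
    rw [hβ, Equiv.apply_symm_apply, Equiv.apply_symm_apply]
  have hw : ∀ a, (fun j => (u ∘ ⇑β) (e.symm (a, j))) = (fun j => u (e.symm (σ a, j))) := by
    intro a; funext j; simp only [Function.comp_apply, hblk]
  unfold wordBlockSign
  simp only [hw]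
  by_cases hb : ∀ a, Function.Bijective (fun j => u (e.symm (a, j)))
  · have hb' : ∀ a, Function.Bijective (fun j => u (e.symm (σ a, j))) := fun a => hb (σ a)
    rw [if_pos hb', if_pos hb]
    exact Equiv.prod_comp σ (fun a => (((Kumar2015.seqSign (fun j => u (e.symm (a, j))) : ℤˣ) : ℤ) : ℂ))
  · have hb' : ¬ ∀ a, Function.Bijective (fun j => u (e.symm (σ a, j))) := by
      intro h'
      apply hb
      intro a
      have h2 := h' (σ.symm a)
      rwa [Equiv.apply_symm_apply] at h2
    rw [if_neg hb', if_neg hb]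

/-! ### §3 The double cross `κ = (A B)(C D)` -/

section DoubleCross

variable {D N : ℕ} (e : Fin D ≃ Fin 2 × Fin N) {b b' : Fin 2} {s s' : Fin N} {A B C D' : Fin D}

/-- The four cells of a double cross are pairwise distinct. [folklore] -/
theorem doubleCross_cells_ne (hbb' : b ≠ b') (hss' : s ≠ s') (hA : e A = (b, s)) (hB : e B = (b', s))
    (hC : e C = (b, s')) (hD : e D' = (b', s')) :
    A ≠ B ∧ A ≠ C ∧ A ≠ D' ∧ B ≠ C ∧ B ≠ D' ∧ C ≠ D' := by
  refine ⟨fun h => ?_, fun h => ?_, fun h => ?_, fun h => ?_, fun h => ?_, fun h => ?_⟩ <;>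
    have h' := congrArg e h <;> simp only [hA, hB, hC, hD, Prod.mk.injEq] at h'
  · exact hbb' h'.1
  · exact hss' h'.2
  · exact hbb' h'.1
  · exact hbb' h'.1.symm
  · exact hss' h'.2
  · exact hbb' h'.1

/-- Reading the cells of a double cross back from the block coordinates. [folklore] -/
theorem doubleCross_symm_apply (hA : e A = (b, s)) (hB : e B = (b', s)) (hC : e C = (b, s')) (hD : e D' = (b', s')) :
    e.symm (b, s) = A ∧ e.symm (b', s) = B ∧ e.symm (b, s') = C ∧ e.symm (b', s') = D' := by
  refine ⟨?_, ?_, ?_, ?_⟩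
  · rw [← hA, Equiv.symm_apply_apply]
  · rw [← hB, Equiv.symm_apply_apply]
  · rw [← hC, Equiv.symm_apply_apply]
  · rw [← hD, Equiv.symm_apply_apply]

/-- The double cross on its four cells and off them. [folklore] -/
theorem doubleCross_apply (hbb' : b ≠ b') (hss' : s ≠ s') (hA : e A = (b, s)) (hB : e B = (b', s))
    (hC : e C = (b, s')) (hD : e D' = (b', s')) :
    (Equiv.swap A B * Equiv.swap C D') A = B ∧ (Equiv.swap A B * Equiv.swap C D') B = A ∧
      (Equiv.swap A B * Equiv.swap C D') C = D' ∧ (Equiv.swap A B * Equiv.swap C D') D' = C ∧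
      ∀ q, q ≠ A → q ≠ B → q ≠ C → q ≠ D' → (Equiv.swap A B * Equiv.swap C D') q = q := by
  obtain ⟨hAB, hAC, hAD, hBC, hBD, hCD⟩ := doubleCross_cells_ne e hbb' hss' hA hB hC hD
  refine ⟨?_, ?_, ?_, ?_, fun q h1 h2 h3 h4 => ?_⟩ <;> rw [Equiv.Perm.mul_apply]
  · rw [Equiv.swap_apply_of_ne_of_ne hAC hAD, Equiv.swap_apply_left]
  · rw [Equiv.swap_apply_of_ne_of_ne hBC hBD, Equiv.swap_apply_right]
  · rw [Equiv.swap_apply_left, Equiv.swap_apply_of_ne_of_ne hAD.symm hBD.symm]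
  · rw [Equiv.swap_apply_right, Equiv.swap_apply_of_ne_of_ne hAC.symm hBC.symm]
  · rw [Equiv.swap_apply_of_ne_of_ne h3 h4, Equiv.swap_apply_of_ne_of_ne h1 h2]

/-- **`ζ_e(u ∘ κ) = ζ_e(u)` for the double cross `κ = (A B)(C D)`**, as soon as both words are block-bijective: at the two
slots the blocks of `u ∘ κ` and `u` either agree (then `u ∘ κ = u`) or cross (then `u ∘ κ` is `u` with one transposition
inside each block). [this node] -/
theorem wordBlockSign_comp_doubleCross (hbb' : b ≠ b') (hss' : s ≠ s') (hA : e A = (b, s)) (hB : e B = (b', s))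
    (hC : e C = (b, s')) (hD : e D' = (b', s')) (u : Word N D) (hu : wordBlockSign ℂ e u ≠ 0)
    (huκ : wordBlockSign ℂ e (u ∘ ⇑(Equiv.swap A B * Equiv.swap C D')) ≠ 0) :
    wordBlockSign ℂ e (u ∘ ⇑(Equiv.swap A B * Equiv.swap C D')) = wordBlockSign ℂ e u := by
  obtain ⟨hAB, hAC, hAD, hBC, hBD, hCD⟩ := doubleCross_cells_ne e hbb' hss' hA hB hC hD
  obtain ⟨hκA, hκB, hκC, hκD, hκq⟩ := doubleCross_apply e hbb' hss' hA hB hC hD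
  obtain ⟨hsA, hsB, hsC, hsD⟩ := doubleCross_symm_apply e hA hB hC hD
  have hf := bijective_of_wordBlockSign_ne_zero e hu b
  have hg := bijective_of_wordBlockSign_ne_zero e huκ b
  have hagree : ∀ j, j ≠ s → j ≠ s' →
      (fun j => u (e.symm (b, j))) j = (fun j => (u ∘ ⇑(Equiv.swap A B * Equiv.swap C D')) (e.symm (b, j))) j := by
    intro j hj hj'
    show u (e.symm (b, j)) = u ((Equiv.swap A B * Equiv.swap C D') (e.symm (b, j)))
    rw [hκq]
    · intro h; exact hj (blockEquiv_symm_apply_eq e h |>.2.trans (by rw [hA]))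
    · intro h; exact hbb' (blockEquiv_symm_apply_eq e h |>.1.trans (by rw [hB]))
    · intro h; exact hj' (blockEquiv_symm_apply_eq e h |>.2.trans (by rw [hC]))
    · intro h; exact hbb' (blockEquiv_symm_apply_eq e h |>.1.trans (by rw [hD]))
  have hAe : (e A).1 = b := by rw [hA]
  have hBe : (e B).1 = b' := by rw [hB]
  have hCe : (e C).1 = b := by rw [hC]
  have hDe : (e D').1 = b' := by rw [hD]
  rcases bijective_agree_off_two hf hg hss' hagree with ⟨h1, h2⟩ | ⟨h1, h2⟩
  · -- straight: `u ∘ κ = u`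
    have h1' : u A = u B := by simpa only [Function.comp_apply, hsA, hκA] using h1
    have h2' : u C = u D' := by simpa only [Function.comp_apply, hsC, hκC] using h2
    have huu : u ∘ ⇑(Equiv.swap A B * Equiv.swap C D') = u := by
      refine funext_off_four A B C D' ?_ ?_ ?_ ?_ fun q q1 q2 q3 q4 => ?_
      · simp only [Function.comp_apply, hκA, h1']
      · simp only [Function.comp_apply, hκB, h1']
      · simp only [Function.comp_apply, hκC, h2']
      · simp only [Function.comp_apply, hκD, h2']
      · simp only [Function.comp_apply, hκq q q1 q2 q3 q4]
    rw [huu]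
  · -- crossed: `u ∘ κ = u ∘ (A C) ∘ (B D)`
    have h1' : u A = u D' := by simpa only [Function.comp_apply, hsA, hsC, hκC] using h1
    have h2' : u C = u B := by simpa only [Function.comp_apply, hsA, hsC, hκA] using h2
    have huu : u ∘ ⇑(Equiv.swap A B * Equiv.swap C D') = (u ∘ ⇑(Equiv.swap A C)) ∘ ⇑(Equiv.swap B D') := by
      refine funext_off_four A B C D' ?_ ?_ ?_ ?_ fun q q1 q2 q3 q4 => ?_
      · simp only [Function.comp_apply, hκA, Equiv.swap_apply_of_ne_of_ne hAB hAD, Equiv.swap_apply_left, h2']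
      · simp only [Function.comp_apply, hκB, Equiv.swap_apply_left, Equiv.swap_apply_of_ne_of_ne hAD.symm hCD.symm, h1']
      · simp only [Function.comp_apply, hκC, Equiv.swap_apply_of_ne_of_ne hBC.symm hCD, Equiv.swap_apply_right, h1']
      · simp only [Function.comp_apply, hκD, Equiv.swap_apply_right, Equiv.swap_apply_of_ne_of_ne hAB.symm hBC, h2']
      · simp only [Function.comp_apply, hκq q q1 q2 q3 q4, Equiv.swap_apply_of_ne_of_ne q2 q4,
          Equiv.swap_apply_of_ne_of_ne q1 q3]
    rw [huu, wordBlockSign_comp_swap ℂ e hBD (by rw [hBe, hDe]), wordBlockSign_comp_swap ℂ e hAC (by rw [hAe, hCe]), neg_neg]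

/-! ### §4 The three value patterns of the separated configurations -/

/-- **Diagonal lifted pair** (`N` at `A`, `M` at `D`): if `χ` agrees with `x` off `A,B,C,D` and `χ(B) = x(D)`,
`χ(C) = x(A)`, then `ζ_e(χ) = ζ_e(x)` — `χ` is `x ∘ (A C)(B D)` off the cross pair `{A, D}`. [this node] -/
theorem twist_diag_eq (hbb' : b ≠ b') (hss' : s ≠ s') (hA : e A = (b, s)) (hB : e B = (b', s)) (hC : e C = (b, s'))
    (hD : e D' = (b', s')) {x χ : Word N D} (hx : wordBlockSign ℂ e x ≠ 0) (hχ : wordBlockSign ℂ e χ ≠ 0)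
    (h : ∀ q, q ≠ A → q ≠ B → q ≠ C → q ≠ D' → χ q = x q) (hχB : χ B = x D') (hχC : χ C = x A) :
    wordBlockSign ℂ e χ = wordBlockSign ℂ e x := by
  obtain ⟨hAB, hAC, hAD, hBC, hBD, hCD⟩ := doubleCross_cells_ne e hbb' hss' hA hB hC hD
  have hx'' : wordBlockSign ℂ e ((x ∘ ⇑(Equiv.swap A C)) ∘ ⇑(Equiv.swap B D')) = wordBlockSign ℂ e x := by
    rw [wordBlockSign_comp_swap ℂ e hBD (by rw [hB, hD]), wordBlockSign_comp_swap ℂ e hAC (by rw [hA, hC]), neg_neg]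
  have heq : χ = (x ∘ ⇑(Equiv.swap A C)) ∘ ⇑(Equiv.swap B D') := by
    refine word_eq_of_agree_off_cross e hχ (by rw [hx'']; exact hx) (p := A) (p' := D')
      (by rw [hA, hD]; exact hbb') fun q hqA hqD => ?_
    by_cases hqB : q = B
    · rw [hqB, hχB]
      simp only [Function.comp_apply, Equiv.swap_apply_left, Equiv.swap_apply_of_ne_of_ne hAD.symm hCD.symm]
    by_cases hqC : q = C
    · rw [hqC, hχC]
      simp only [Function.comp_apply, Equiv.swap_apply_of_ne_of_ne hBC.symm hCD, Equiv.swap_apply_right]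
    rw [h q hqA hqB hqC hqD]
    simp only [Function.comp_apply, Equiv.swap_apply_of_ne_of_ne hqB hqD, Equiv.swap_apply_of_ne_of_ne hqA hqC]
  rw [heq, hx'']

/-- **Vertical crossed pair** (`i₀` at `A`, `one` at `B`, `N` at `P`, `M` at `M'` off the cross): if `x(P) = x(A)`,
`x(M') = x(B)`, `χ` agrees with `x` off the six cells and `χ(P) = x(M')`, `χ(M') = x(P)`, `χ(A) = x(B)`, `χ(B) = x(A)`, then
`ζ_e(χ) = ζ_e(x)` — `χ` is `x ∘ (M' A)(P B)` off the cross pair `{C, D}`. [this node] -/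
theorem twist_vertPair_eq (hbb' : b ≠ b') (hss' : s ≠ s') (hA : e A = (b, s)) (hB : e B = (b', s)) (hC : e C = (b, s'))
    (hD : e D' = (b', s')) {x χ : Word N D} (hx : wordBlockSign ℂ e x ≠ 0) (hχ : wordBlockSign ℂ e χ ≠ 0) {P M' : Fin D}
    (hPe : (e P).1 = b') (hMe : (e M').1 = b) (hPM : P ≠ M') (hPB : P ≠ B) (hMA : M' ≠ A)
    (hxP : x P = x A) (hxM : x M' = x B)
    (h : ∀ q, q ≠ P → q ≠ M' → q ≠ A → q ≠ B → q ≠ C → q ≠ D' → χ q = x q)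
    (hχP : χ P = x M') (hχM : χ M' = x P) (hχA : χ A = x B) (hχB : χ B = x A) :
    wordBlockSign ℂ e χ = wordBlockSign ℂ e x := by
  obtain ⟨hAB, hAC, hAD, hBC, hBD, hCD⟩ := doubleCross_cells_ne e hbb' hss' hA hB hC hD
  have hAe : (e A).1 = b := by rw [hA]
  have hBe : (e B).1 = b' := by rw [hB]
  have hPA : P ≠ A := fun h' => hbb' (by rw [← hAe, ← h', hPe])
  have hMB : M' ≠ B := fun h' => hbb' (by rw [← hMe, h', hBe])
  have hx'' : wordBlockSign ℂ e ((x ∘ ⇑(Equiv.swap M' A)) ∘ ⇑(Equiv.swap P B)) = wordBlockSign ℂ e x := by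
    rw [wordBlockSign_comp_swap ℂ e hPB (by rw [hPe, hBe]), wordBlockSign_comp_swap ℂ e hMA (by rw [hMe, hAe]), neg_neg]
  have heq : χ = (x ∘ ⇑(Equiv.swap M' A)) ∘ ⇑(Equiv.swap P B) := by
    refine word_eq_of_agree_off_cross e hχ (by rw [hx'']; exact hx) (p := C) (p' := D')
      (by rw [hC, hD]; exact hbb') fun q hqC hqD => ?_
    by_cases hqP : q = P
    · rw [hqP, hχP]
      simp only [Function.comp_apply, Equiv.swap_apply_left, Equiv.swap_apply_of_ne_of_ne hMB.symm hAB.symm, hxM]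
    by_cases hqM : q = M'
    · rw [hqM, hχM]
      simp only [Function.comp_apply, Equiv.swap_apply_of_ne_of_ne hPM.symm hMB, Equiv.swap_apply_left, hxP]
    by_cases hqA : q = A
    · rw [hqA, hχA]
      simp only [Function.comp_apply, Equiv.swap_apply_of_ne_of_ne hPA.symm hAB, Equiv.swap_apply_right, hxM]
    by_cases hqB : q = B
    · rw [hqB, hχB]
      simp only [Function.comp_apply, Equiv.swap_apply_right, Equiv.swap_apply_of_ne_of_ne hPM hPA, hxP]
    rw [h q hqP hqM hqA hqB hqC hqD]
    simp only [Function.comp_apply, Equiv.swap_apply_of_ne_of_ne hqP hqB, Equiv.swap_apply_of_ne_of_ne hqM hqA]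
  rw [heq, hx'']

/-- **Diagonal crossed pair** (`i₀` at `A`, `one` at `D`, `N` at `P`, `M` at `M'` off the cross): if `x(P) = x(A)`,
`x(M') = x(D)`, `χ` agrees with `x` off the six cells and `χ(P) = x(M')`, `χ(M') = x(P)`, `χ(B) = x(A)`, `χ(C) = x(D)`, then
`ζ_e(χ) = ζ_e(x)` — `χ` is `x ∘ (M' A)(A C)(P D)(D B)` (two 3-cycles inside the blocks) off the cross pair `{A, D}`.
[this node] -/
theorem twist_diagPair_eq (hbb' : b ≠ b') (hss' : s ≠ s') (hA : e A = (b, s)) (hB : e B = (b', s)) (hC : e C = (b, s'))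
    (hD : e D' = (b', s')) {x χ : Word N D} (hx : wordBlockSign ℂ e x ≠ 0) (hχ : wordBlockSign ℂ e χ ≠ 0) {P M' : Fin D}
    (hPe : (e P).1 = b') (hMe : (e M').1 = b) (hPM : P ≠ M') (hPB : P ≠ B) (hPD : P ≠ D') (hMA : M' ≠ A) (hMC : M' ≠ C)
    (hxP : x P = x A) (hxM : x M' = x D')
    (h : ∀ q, q ≠ P → q ≠ M' → q ≠ A → q ≠ B → q ≠ C → q ≠ D' → χ q = x q)
    (hχP : χ P = x M') (hχM : χ M' = x P) (hχB : χ B = x A) (hχC : χ C = x D') :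
    wordBlockSign ℂ e χ = wordBlockSign ℂ e x := by
  obtain ⟨hAB, hAC, hAD, hBC, hBD, hCD⟩ := doubleCross_cells_ne e hbb' hss' hA hB hC hD
  have hAe : (e A).1 = b := by rw [hA]
  have hBe : (e B).1 = b' := by rw [hB]
  have hCe : (e C).1 = b := by rw [hC]
  have hDe : (e D').1 = b' := by rw [hD]
  have hPA : P ≠ A := fun h' => hbb' (by rw [← hAe, ← h', hPe])
  have hPC : P ≠ C := fun h' => hbb' (by rw [← hCe, ← h', hPe])
  have hMB : M' ≠ B := fun h' => hbb' (by rw [← hMe, h', hBe])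
  have hMD : M' ≠ D' := fun h' => hbb' (by rw [← hMe, h', hDe])
  have hx'' : wordBlockSign ℂ e
      ((((x ∘ ⇑(Equiv.swap M' A)) ∘ ⇑(Equiv.swap A C)) ∘ ⇑(Equiv.swap P D')) ∘ ⇑(Equiv.swap D' B)) =
        wordBlockSign ℂ e x := by
    rw [wordBlockSign_comp_swap ℂ e hBD.symm (by rw [hDe, hBe]), wordBlockSign_comp_swap ℂ e hPD (by rw [hPe, hDe]),
      wordBlockSign_comp_swap ℂ e hAC (by rw [hAe, hCe]), wordBlockSign_comp_swap ℂ e hMA (by rw [hMe, hAe]), neg_neg, neg_neg]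
  have heq : χ = (((x ∘ ⇑(Equiv.swap M' A)) ∘ ⇑(Equiv.swap A C)) ∘ ⇑(Equiv.swap P D')) ∘ ⇑(Equiv.swap D' B) := by
    refine word_eq_of_agree_off_cross e hχ (by rw [hx'']; exact hx) (p := A) (p' := D')
      (by rw [hAe, hDe]; exact hbb') fun q hqA hqD => ?_
    by_cases hqP : q = P
    · rw [hqP, hχP]
      simp only [Function.comp_apply, Equiv.swap_apply_of_ne_of_ne hPD hPB, Equiv.swap_apply_left,
        Equiv.swap_apply_of_ne_of_ne hAD.symm hCD.symm, Equiv.swap_apply_of_ne_of_ne hMD.symm hAD.symm, hxM]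
    by_cases hqM : q = M'
    · rw [hqM, hχM]
      simp only [Function.comp_apply, Equiv.swap_apply_of_ne_of_ne hMD hMB, Equiv.swap_apply_of_ne_of_ne hPM.symm hMD,
        Equiv.swap_apply_of_ne_of_ne hMA hMC, Equiv.swap_apply_left, hxP]
    by_cases hqB : q = B
    · rw [hqB, hχB]
      simp only [Function.comp_apply, Equiv.swap_apply_right, Equiv.swap_apply_of_ne_of_ne hPA hPC,
        Equiv.swap_apply_of_ne_of_ne hPM hPA, hxP]
    by_cases hqC : q = C
    · rw [hqC, hχC]
      simp only [Function.comp_apply, Equiv.swap_apply_of_ne_of_ne hCD hBC.symm, Equiv.swap_apply_of_ne_of_ne hPC.symm hCD,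
        Equiv.swap_apply_right, hxM]
    rw [h q hqP hqM hqA hqB hqC hqD]
    simp only [Function.comp_apply, Equiv.swap_apply_of_ne_of_ne hqD hqB, Equiv.swap_apply_of_ne_of_ne hqP hqD,
      Equiv.swap_apply_of_ne_of_ne hqA hqC, Equiv.swap_apply_of_ne_of_ne hqM hqA]
  rw [heq, hx'']

end DoubleCross

end Summit.MatrixMultiplication.MatrixMultiplication.Theorems.ObstructionCalculus

end
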